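import Mathlib.RingTheory.Localization.Module
import Mathlib.NumberTheory.PrimeCounting
import Literature.NumberTheory.LFunctions.SaiasWeingartner
import Literature.NumberTheory.LFunctions.HybridJointUniversality
import Literature.NumberTheory.LFunctions.UniversalityZeros
import Literature.NumberTheory.LFunctions.FiniteLSeries
import Literature.NumberTheory.DiophantineApproximation.KroneckerWeyl
import HarnessLib

/-!
# Saias–Weingartner 2009, Theorem 2 inside the critical strip, from hybrid joint universality

Topic `Literature/NumberTheory/LFunctions` (namespace `Literature.NumberTheory.LFunctions`).
Everything in this file is PROVED. It carries out the derivation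
"hybrid joint universality ⟹ `≫ T` distinct zeros of `F(s) = ∑ⱼ Pⱼ(s) L(s, χⱼ)` in every strip
`σ₁ < Re s < σ₂` of the critical strip" — the proof of [Pankowski2010], Cor. 5.3 (pp. 70–71),
which is Theorem 2 of [KaczorowskiKulas2006] as quoted in [SaiasWeingartner2009], §4, first
sentence ("If `σ₁ < 1` then `N'_F(σ₁, σ₂, T) ≫ T` by Theorem 2 of [KK07]. We may thus restrict our
attention to the case `σ₁ ≥ 1`"; also §1, arXiv p. 3: "The case `η = 0` in Theorem 2 follows from
[KK07], Theorem 2"):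

* `SaiasWeingartner2009_thm2_left_of_pankowski` — **the left half of Theorem 2** (strips with
  `1/2 ≤ σ₁ < σ₂ ≤ 1`) for every Saias–Weingartner family `IsSWFamily χ P`, from the named fact
  `Pankowski2010_thm1_1_discAnalytic` (hybrid joint universality of Dirichlet `L`-functions on
  discs, for targets analytic on a neighbourhood of the disc — the form the printed proof of
  Cor. 5.3 uses; `HybridJointUniversality.lean`);
* `saiasWeingartner_thm2_of_pankowski` — **Theorem 2 in full** (an `η = η(F) > 0` covering all
  strips with `1/2 ≤ σ₁ < σ₂ ≤ 1 + η`) from `Pankowski2010_thm1_1_discAnalytic` and the right half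
  `SaiasWeingartner2009_thm2_right` (§4 of the paper, the named fact of `SaiasWeingartner.lean`),
  by the case distinction of §4's first sentence: a strip with `σ₁ < 1` contains the strip
  `σ₁ < Re s < min(σ₂, 1)` of the critical strip.

D-0026 bookkeeping (split review, 2026-08-15). The left half was first vendored as a separate
named fact `SaiasWeingartner2009_thm2_left` (p23235) next to `SaiasWeingartner2009_thm2_right`.
Once reduced to `Pankowski2010_thm1_1_discAnalytic` by the theorem below it carried no proof
obligation of its own (what remains is exactly the discharge of that pre-existing fact, which
contains Voronin's universality theorem and is not small), so it was MERGED BACK into the proof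
obligation of its parent `Literature.Barriers.RiemannHypothesis.SaiasWeingartner`: the statement
of Kaczorowski–Kulas's theorem is kept verbatim as the (explicit) conclusion of
`SaiasWeingartner2009_thm2_left_of_pankowski`, and the barrier fact follows from
`Pankowski2010_thm1_1_discAnalytic` and `SaiasWeingartner2009_thm2_right` alone
(`Literature.Barriers.RiemannHypothesis.SaiasWeingartner_of_pankowski` in
`DavenportHeilbronnSaiasWeingartnerProofs.lean`, through `saiasWeingartner_thm2_of_pankowski`).

## The argument ([Pankowski2010], proof of Cor. 5.3, with a simpler choice of targets)

Let `F = ∑ⱼ Pⱼ L(·, χⱼ)` with at least two indices `i₁ ≠ i₂`, pairwise distinct primitive `χⱼ` and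
non-zero Dirichlet polynomials `Pⱼ`, and let `1/2 ≤ σ₁ < σ₂ ≤ 1`.
1. (`exists_mem_Ioo_ne_zero_and_ne_zero`) Non-zero Dirichlet polynomials are entire and not
   identically zero, so by isolated zeros there is a real `σ₀ ∈ (σ₁, σ₂)` with
   `P_{i₁}(σ₀) ≠ 0 ≠ P_{i₂}(σ₀)`.
2. Targets: `fⱼ := wⱼ` (non-zero constants, `w_{i₁} = 1`, `wⱼ = t` small otherwise) for `j ≠ i₂`
   and `f_{i₂}(s) := ((s − σ₀) − R(s)) / P_{i₂}(s)` with `R := ∑_{j ≠ i₂} wⱼ Pⱼ`; `t` is chosen so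
   that `R(σ₀) ≠ 0`, whence `f_{i₂}(σ₀) ≠ 0`; all `fⱼ` are analytic and zero-free on an open disc
   `|s − σ₀| < ρ`, and on a smaller closed disc `K = {|s − σ₀| ≤ r}` (`r < ρ`) inside the strip
   `max(σ₁, 1/2) < Re s < min(σ₂, 1)` we have `∑ⱼ Pⱼ fⱼ = s − σ₀`.
3. Hybrid joint universality (`Pankowski2010_thm1_1_discAnalytic`, with the disc `K` and the
   analyticity radius `ρ`) with the frequencies
   `αₚ = −log p / 2π`, `p ≤ Q` prime (`Q` beyond all supports; `ℚ`-linearly independent by unique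
   factorisation, `KroneckerWeyl.linearIndependent_neg_log_prime_div`) and phases `θₚ = 0` yields a
   set `A` of shifts `τ` of positive lower density with `|L(s + iτ, χⱼ) − fⱼ(s)| < ε` on `K` and
   `‖τ αₚ‖ < ε`; the latter gives `|n^{-iτ} − 1| ≤ 2πnε` on the supports
   (`FiniteLSeries.lean`), hence `|Pⱼ(s + iτ) − Pⱼ(s)|` small, and altogether
   `|F(s + iτ) − (s − σ₀)| < r/2` on `K`.
4. Rouché in maximum-modulus form (`exists_zero_of_norm_sub_lt`) gives a zero of `F` in
   `|z − (σ₀ + iτ)| < r` for every `τ ∈ A`, and the counting lemma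
   `exists_finset_zeros_of_density` turns positive lower density into `≥ cT` distinct zeros with
   `|Re z − σ₀| < r`, `|Im z| ≤ T`, i.e. `HasLinearlyManyZeros F σ₁ σ₂`.

## References

* [Pankowski2010] Ł. Pańkowski, *Hybrid joint universality theorem for Dirichlet L-functions*,
  Acta Arith. 141 (2010), 59–72, Theorem 1.1 and Cor. 5.3 with its proof (pp. 70–71). Read
  (held copy, `doi:10.4064/aa141-1-3`).
* [SaiasWeingartner2009] E. Saias, A. Weingartner, *Zeros of Dirichlet series with periodic
  coefficients*, Acta Arith. 140 (2009), 335–344, Theorem 2, §1 and §4 (read,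
  arXiv:0807.0783, pp. 3 and 8).
* [KaczorowskiKulas2006] J. Kaczorowski, M. Kulas, Monatsh. Math. 150, 217–232, Theorem 2 (not
  held; quoted through the two sources above).
-/

noncomputable section

open Complex Set Metric MeasureTheory Filter
open scoped _root_.Topology

namespace Literature.NumberTheory.LFunctions

/-! ### Isolated zeros on a real segment -/

/-- **Two entire functions, neither identically zero, are simultaneously non-zero at some real
point of any non-degenerate real interval** (principle of isolated zeros at the midpoint, pulled
back to the real line). [folklore] -/
theorem exists_mem_Ioo_ne_zero_and_ne_zero {f g : ℂ → ℂ} (hf : AnalyticOnNhd ℂ f univ)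
    (hg : AnalyticOnNhd ℂ g univ) (hf0 : f ≠ 0) (hg0 : g ≠ 0) {a b : ℝ} (hab : a < b) :
    ∃ x : ℝ, a < x ∧ x < b ∧ f x ≠ 0 ∧ g x ≠ 0 := by
  set m : ℝ := (a + b) / 2 with hm
  have key : ∀ {h : ℂ → ℂ}, AnalyticOnNhd ℂ h univ → h ≠ 0 →
      ∀ᶠ z in 𝓝[≠] (m : ℂ), h z ≠ 0 := by
    intro h hh hh0
    rcases (hh (m : ℂ) (mem_univ _)).eventually_eq_zero_or_eventually_ne_zero with h1 | h1
    · exact absurd (funext fun z ↦ hh.eqOn_zero_of_preconnected_of_eventuallyEq_zero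
        isPreconnected_univ (mem_univ _) h1 (mem_univ z)) hh0
    · exact h1
  have htend : Tendsto (fun x : ℝ ↦ (x : ℂ)) (𝓝[≠] m) (𝓝[≠] (m : ℂ)) :=
    tendsto_nhdsWithin_of_tendsto_nhds_of_eventually_within _
      (Complex.continuous_ofReal.continuousAt.tendsto.mono_left nhdsWithin_le_nhds)
      (eventually_mem_nhdsWithin.mono fun x hx ↦ by
        simpa only [mem_compl_iff, mem_singleton_iff, Complex.ofReal_inj] using hx)
  have hIoo : ∀ᶠ x in 𝓝[≠] m, a < x ∧ x < b :=
    nhdsWithin_le_nhds (Ioo_mem_nhds (by rw [hm]; linarith) (by rw [hm]; linarith))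
  obtain ⟨x, ⟨hx1, hx2⟩, hx3, hx4⟩ :=
    (hIoo.and (htend.eventually ((key hf hf0).and (key hg hg0)))).exists
  exact ⟨x, hx1, hx2, hx3, hx4⟩

/-! ### The reduction -/

/-- **Saias–Weingartner 2009, Theorem 2, strips inside the critical strip (Kaczorowski–Kulas),
from hybrid joint universality.** "If `σ₁ < 1` then `N'_F(σ₁, σ₂, T) ≫_{F,σ₁,σ₂} T` by Theorem 2
of [KK07]": for `F = ∑ⱼ Pⱼ L(·, χⱼ)` as in Theorem 2 (`IsSWFamily χ P`: at least two indices,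
pairwise distinct primitive characters, non-zero Dirichlet polynomials) and all
`1/2 ≤ σ₁ < σ₂ ≤ 1`, `N'_F(σ₁, σ₂, T) ≫ T` for all sufficiently large `T`
(`HasLinearlyManyZeros`, zeros counted without multiplicity) — derived from the disc form
`Pankowski2010_thm1_1_discAnalytic` of Pańkowski's Theorem 1.1 by the targets
`∑ⱼ Pⱼ fⱼ = s − σ₀` (analytic on a neighbourhood of the disc), the phases `αₚ = −log p / 2π`,
Rouché's theorem and the counting of shifts of positive lower density, as in the proof of
[Pankowski2010], Cor. 5.3 ("for every `1/2 < σ₁ < σ₂ < 1` the number of zeros of `F(s)` in the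
rectangle `σ₁ ≤ σ ≤ σ₂`, `0 < t < T` is `≫ T`"; the endpoints `σ₁ = 1/2`, `σ₂ = 1` are covered
because the zeros produced lie in a closed sub-strip). This theorem IS the in-tree form of the
left half of Theorem 2 (no separate named fact; see the module docstring).
[cite: SaiasWeingartner2009, Thm. 2 and §4 (case σ₁ < 1)] [cite: KaczorowskiKulas2006, Thm. 2]
[cite: Pankowski2010, Cor. 5.3 (proof)] -/
theorem SaiasWeingartner2009_thm2_left_of_pankowski (hU : Pankowski2010_thm1_1_discAnalytic)
    (ι : Type) [Fintype ι] (q : ι → ℕ) [∀ i, NeZero (q i)] (χ : ∀ i, DirichletCharacter ℂ (q i))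
    (P : ι → ℕ → ℂ) (hF : IsSWFamily χ P) (σ₁ σ₂ : ℝ) (h₁ : 1 / 2 ≤ σ₁) (h₁₂ : σ₁ < σ₂)
    (h₂ : σ₂ ≤ 1) : HasLinearlyManyZeros (charCombination χ P) σ₁ σ₂ := by
  classical
  haveI : Nonempty ι := hF.nonempty
  obtain ⟨i₁, i₂, hne⟩ := hF.exists_pair_ne
  have hsupp := hF.finite_support
  /- Step 1: the centre `σ₀`. -/
  obtain ⟨σ₀, hσ₁, hσ₂, hP₁, hP₂⟩ :
      ∃ σ₀ : ℝ, σ₁ < σ₀ ∧ σ₀ < σ₂ ∧ LSeries (P i₁) σ₀ ≠ 0 ∧ LSeries (P i₂) σ₀ ≠ 0 :=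
    exists_mem_Ioo_ne_zero_and_ne_zero (fun s _ ↦ FiniteLSeries.analyticAt (hsupp i₁) s)
      (fun s _ ↦ FiniteLSeries.analyticAt (hsupp i₂) s)
      (FiniteLSeries.ne_zero (hsupp i₁) (hF.exists_ne_zero i₁))
      (FiniteLSeries.ne_zero (hsupp i₂) (hF.exists_ne_zero i₂)) h₁₂
  /- Step 2: the weights `w` and the auxiliary polynomial `R = ∑_{j ≠ i₂} wⱼ Pⱼ`, `R(σ₀) ≠ 0`. -/
  set S₀ : ℂ := ∑ j ∈ (Finset.univ.erase i₂).erase i₁, LSeries (P j) σ₀ with hS₀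
  have hnorm : 0 < ‖LSeries (P i₁) σ₀‖ := norm_pos_iff.2 hP₁
  set t : ℝ := ‖LSeries (P i₁) σ₀‖ / (2 * (‖S₀‖ + 1)) with ht
  have ht0 : 0 < t := div_pos hnorm (by positivity)
  set w : ι → ℂ := fun j ↦ if j = i₁ then 1 else (t : ℂ) with hw
  have hw0 : ∀ j, w j ≠ 0 := by
    intro j
    by_cases hj : j = i₁ <;> simp [hw, hj, ht0.ne']
  set R : ℂ → ℂ := fun s ↦ ∑ j ∈ Finset.univ.erase i₂, w j * LSeries (P j) s with hR
  have hRσ₀ : R σ₀ ≠ 0 := by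
    have hi₁ : i₁ ∈ Finset.univ.erase i₂ := Finset.mem_erase.2 ⟨hne, Finset.mem_univ _⟩
    have hsum : R σ₀ = LSeries (P i₁) σ₀ + t * S₀ := by
      simp only [hR]
      rw [← Finset.add_sum_erase _ _ hi₁]
      congr 1
      · simp [hw]
      · rw [hS₀, Finset.mul_sum]
        refine Finset.sum_congr rfl fun j hj ↦ ?_
        have hji : j ≠ i₁ := (Finset.mem_erase.1 hj).1
        simp [hw, hji]
    rw [hsum]
    intro h0
    have he : LSeries (P i₁) σ₀ = -(t * S₀) := eq_neg_of_add_eq_zero_left h0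
    have hn1 : ‖LSeries (P i₁) σ₀‖ = t * ‖S₀‖ := by
      rw [he, norm_neg, norm_mul, Complex.norm_real, Real.norm_eq_abs, abs_of_pos ht0]
    have hn2 : t * ‖S₀‖ < ‖LSeries (P i₁) σ₀‖ := by
      rw [ht, div_mul_eq_mul_div, div_lt_iff₀ (by positivity)]
      nlinarith [norm_nonneg S₀]
    linarith
  have hRdiff : Differentiable ℂ R := fun s ↦
    DifferentiableAt.fun_sum fun j _ ↦
      (differentiableAt_const _).mul (FiniteLSeries.differentiable (hsupp j) s)
  /- Step 3: the targets. -/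
  set f₂ : ℂ → ℂ := fun s ↦ ((s - σ₀) - R s) / LSeries (P i₂) s with hf₂def
  set f : ι → ℂ → ℂ := fun j ↦ if j = i₂ then f₂ else fun _ ↦ w j with hfdef
  have hf_i₂ : f i₂ = f₂ := by simp [hfdef]
  have hf_ne : ∀ j, j ≠ i₂ → f j = fun _ ↦ w j := fun j hj ↦ by simp [hfdef, hj]
  have hf₂diff : ∀ s, LSeries (P i₂) s ≠ 0 → DifferentiableAt ℂ f₂ s := fun s hs ↦
    ((differentiableAt_id.sub (differentiableAt_const _)).sub (hRdiff s)).div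
      (FiniteLSeries.differentiable (hsupp i₂) s) hs
  have hf₂σ₀ : f₂ σ₀ ≠ 0 := by
    simp only [hf₂def, sub_self, zero_sub]
    exact div_ne_zero (neg_ne_zero.2 hRσ₀) hP₂
  /- Step 4: the radius `r`. -/
  have hev : ∀ᶠ s in 𝓝 (σ₀ : ℂ), LSeries (P i₂) s ≠ 0 ∧ f₂ s ≠ 0 :=
    ((FiniteLSeries.continuous (hsupp i₂)).continuousAt.eventually_ne hP₂).and
      ((hf₂diff _ hP₂).continuousAt.eventually_ne hf₂σ₀)
  obtain ⟨ρ, hρ, hball⟩ := Metric.eventually_nhds_iff_ball.1 hev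
  have hgap : 0 < min (σ₀ - σ₁) (σ₂ - σ₀) := lt_min (sub_pos.2 hσ₁) (sub_pos.2 hσ₂)
  set r : ℝ := min (ρ / 2) (min (σ₀ - σ₁) (σ₂ - σ₀) / 2) with hr
  have hr0 : 0 < r := lt_min (half_pos hρ) (half_pos hgap)
  have hrρ : r < ρ := (min_le_left _ _).trans_lt (half_lt_self hρ)
  have hr₁ : σ₁ < σ₀ - r := by
    have h1 : r ≤ (σ₀ - σ₁) / 2 :=
      (min_le_right _ _).trans (div_le_div_of_nonneg_right (min_le_left _ _) zero_le_two)
    linarith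
  have hr₂ : σ₀ + r < σ₂ := by
    have h1 : r ≤ (σ₂ - σ₀) / 2 :=
      (min_le_right _ _).trans (div_le_div_of_nonneg_right (min_le_right _ _) zero_le_two)
    linarith
  have h_half : 1 / 2 < σ₀ - r := lt_of_le_of_lt h₁ hr₁
  have h_one : σ₀ + r < 1 := lt_of_lt_of_le hr₂ h₂
  have hK : ∀ s ∈ closedBall (σ₀ : ℂ) r, LSeries (P i₂) s ≠ 0 ∧ f₂ s ≠ 0 := fun s hs ↦
    hball s (closedBall_subset_ball hrρ hs)
  have hre : ∀ z ∈ closedBall (σ₀ : ℂ) r, σ₀ - r ≤ z.re ∧ z.re ≤ σ₀ + r := by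
    intro z hz
    have h := (abs_re_le_norm (z - σ₀)).trans (mem_closedBall_iff_norm.1 hz)
    rw [sub_re, ofReal_re] at h
    constructor <;> linarith [(abs_le.1 h).1, (abs_le.1 h).2]
  /- Step 5: the targets on the discs `ball σ₀ ρ ⊇ closedBall σ₀ r`. -/
  have hfd : ∀ j, DifferentiableOn ℂ (f j) (ball (σ₀ : ℂ) ρ) := by
    intro j
    by_cases hj : j = i₂
    · rw [hj, hf_i₂]
      exact fun s hs ↦ (hf₂diff s (hball s hs).1).differentiableWithinAt
    · rw [hf_ne j hj]
      exact differentiableOn_const _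
  have hfc : ∀ j, ContinuousOn (f j) (closedBall (σ₀ : ℂ) r) := fun j ↦
    (hfd j).continuousOn.mono (closedBall_subset_ball hrρ)
  have hf0 : ∀ j, ∀ s ∈ closedBall (σ₀ : ℂ) r, f j s ≠ 0 := by
    intro j s hs
    by_cases hj : j = i₂
    · rw [hj, hf_i₂]
      exact (hK s hs).2
    · rw [hf_ne j hj]
      exact hw0 j
  have htarget : ∀ s ∈ closedBall (σ₀ : ℂ) r, ∑ j, LSeries (P j) s * f j s = s - σ₀ := by
    intro s hs
    have hP₂s := (hK s hs).1
    rw [← Finset.add_sum_erase _ _ (Finset.mem_univ i₂), hf_i₂]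
    have e1 : LSeries (P i₂) s * f₂ s = (s - σ₀) - R s := by
      simp only [hf₂def]
      field_simp
    have e2 : ∑ j ∈ Finset.univ.erase i₂, LSeries (P j) s * f j s = R s := by
      simp only [hR]
      refine Finset.sum_congr rfl fun j hj ↦ ?_
      rw [hf_ne j (Finset.mem_erase.1 hj).1, mul_comm]
    rw [e1, e2]
    ring
  /- Step 6: constants. -/
  set B : ι → ℝ := fun j ↦ ∑ n ∈ (hsupp j).toFinset, ‖P j n‖ with hB
  set B' : ι → ℝ := fun j ↦ ∑ n ∈ (hsupp j).toFinset with n ≠ 0, ‖P j n‖ * n with hB'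
  have hB0 : ∀ j, 0 ≤ B j := fun j ↦ Finset.sum_nonneg fun n _ ↦ norm_nonneg _
  have hB'0 : ∀ j, 0 ≤ B' j := fun j ↦ Finset.sum_nonneg fun n _ ↦ by positivity
  have hMex : ∀ j, ∃ M : ℝ, ∀ s ∈ closedBall (σ₀ : ℂ) r, ‖f j s‖ ≤ M := fun j ↦
    (isCompact_closedBall _ _).exists_bound_of_continuousOn (hfc j)
  choose M hM using hMex
  set Mf : ℝ := ∑ j, |M j| with hMf
  have hMf0 : 0 ≤ Mf := Finset.sum_nonneg fun j _ ↦ abs_nonneg _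
  have hfM : ∀ j, ∀ s ∈ closedBall (σ₀ : ℂ) r, ‖f j s‖ ≤ Mf := fun j s hs ↦
    ((hM j s hs).trans (le_abs_self _)).trans
      (Finset.single_le_sum (fun k _ ↦ abs_nonneg (M k)) (Finset.mem_univ j))
  set C : ℝ := ∑ j, (B j + 2 * Real.pi * B' j * Mf) with hC
  have hC0 : 0 ≤ C := Finset.sum_nonneg fun j _ ↦ by positivity
  set ε : ℝ := r / (2 * (C + 1)) with hε
  have hε0 : 0 < ε := by positivity
  have hεC : ε * C < r / 2 := by
    rw [hε, div_mul_eq_mul_div, div_lt_div_iff₀ (by positivity) two_pos]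
    nlinarith
  /- Step 7: the support bound `Q` and the frequencies `αₚ = -log p / 2π`, `p ≤ Q` prime. -/
  set Q : ℕ := 2 + ∑ j, (hsupp j).toFinset.sup id with hQ
  have hnQ : ∀ j, ∀ n ∈ (hsupp j).toFinset, n ≤ Q := by
    intro j n hn
    have hn1 : n ≤ (hsupp j).toFinset.sup id := Finset.le_sup (f := id) hn
    have hn2 : (hsupp j).toFinset.sup id ≤ ∑ k, (hsupp k).toFinset.sup id :=
      Finset.single_le_sum (f := fun k ↦ (hsupp k).toFinset.sup id) (fun k _ ↦ Nat.zero_le _)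
        (Finset.mem_univ j)
    omega
  haveI : Nonempty ↥(Nat.primesBelow (Q + 1)) :=
    ⟨⟨2, Nat.mem_primesBelow.2 ⟨by omega, Nat.prime_two⟩⟩⟩
  have hαli : LinearIndependent ℚ
      (fun p : ↥(Nat.primesBelow (Q + 1)) ↦ -Real.log (p : ℕ) / (2 * Real.pi)) :=
    (LinearIndependent.iff_fractionRing ℤ ℚ).1
      (DiophantineApproximation.KroneckerWeyl.linearIndependent_neg_log_prime_div _
        fun p hp ↦ Nat.prime_of_mem_primesBelow hp)
  /- Step 8: hybrid joint universality on the disc `|s − σ₀| ≤ r`, analyticity radius `ρ`. -/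
  obtain ⟨δ, hδ, T₀, hT⟩ := hU ι q χ
    (pairwise_ne_primitiveCharacter_of_isPrimitive χ hF.isPrimitive hF.injective)
    (σ₀ : ℂ) r ρ hr0 hrρ (by rwa [ofReal_re]) (by rwa [ofReal_re]) f hfd hf0 _
    (fun p : ↥(Nat.primesBelow (Q + 1)) ↦ -Real.log (p : ℕ) / (2 * Real.pi)) hαli
    (fun _ ↦ (0 : ℝ)) ε hε0
  /- Step 9: differentiability of `F`. -/
  have hdiffF : ∀ z : ℂ, z.re < 1 → DifferentiableAt ℂ (charCombination χ P) z := by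
    intro z hz
    have hz1 : z ≠ 1 := fun h ↦ by simp [h] at hz
    show DifferentiableAt ℂ (fun s ↦ ∑ i, LSeries (P i) s * (χ i).LFunction s) z
    exact DifferentiableAt.fun_sum fun i _ ↦
      (FiniteLSeries.differentiable (hsupp i) z).mul
        ((χ i).differentiableAt_LFunction z (Or.inl hz1))
  /- Step 10: a zero near `σ₀ + iτ` for every good shift `τ`, then counting. -/
  refine HasLinearlyManyZeros.of_abs_sub_lt hr₁.le hr₂.le
    (exists_finset_zeros_of_density (t₀ := 0) hδ hT hr0 fun τ hτ ↦ ?_)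
  obtain ⟨hτL, hτD⟩ := hτ
  -- phases of the primes `p ≤ Q`, then of all `n ≤ Q`
  have hphase : ∀ p : ℕ, p.Prime → p ≤ Q →
      ‖(p : ℂ) ^ (((-τ : ℝ) : ℂ) * I) - 1‖ ≤ 2 * Real.pi * ε := by
    intro p hp hpQ
    obtain ⟨m, hm⟩ := hτD ⟨p, Nat.mem_primesBelow.2 ⟨Nat.lt_succ_of_le hpQ, hp⟩⟩
    have hm' : |τ * (-Real.log p / (2 * Real.pi)) - m| < ε := by
      have h := hm
      simp only [sub_zero] at h
      exact h
    refine (norm_natCast_cpow_neg_mul_I_sub_one_le_two_pi hp.ne_zero τ m).trans ?_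
    exact mul_le_mul_of_nonneg_left hm'.le (by positivity)
  have hnphase := norm_natCast_cpow_mul_I_sub_one_le (u := -τ)
    (by positivity : (0 : ℝ) ≤ 2 * Real.pi * ε) hphase
  -- the main estimate on the closed disc
  have hclose : ∀ z ∈ closedBall (σ₀ : ℂ) r,
      ‖charCombination χ P (z + τ * I) - (z - σ₀)‖ < r / 2 := by
    intro z hz
    have hz0 : 0 ≤ z.re := by linarith [(hre z hz).1]
    have hzτ0 : 0 ≤ (z + τ * I).re := by simpa using hz0
    rw [← htarget z hz, charCombination_apply, ← Finset.sum_sub_distrib]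
    calc ‖∑ j, (LSeries (P j) (z + τ * I) * (χ j).LFunction (z + τ * I) -
            LSeries (P j) z * f j z)‖
        ≤ ∑ j, ‖LSeries (P j) (z + τ * I) * (χ j).LFunction (z + τ * I) -
            LSeries (P j) z * f j z‖ := norm_sum_le _ _
      _ ≤ ∑ j, (B j * ε + 2 * Real.pi * ε * B' j * Mf) := Finset.sum_le_sum fun j _ ↦ ?_
      _ = ε * C := by
          rw [hC, Finset.mul_sum]
          exact Finset.sum_congr rfl fun j _ ↦ by ring
      _ < r / 2 := hεC
    have e1 : LSeries (P j) (z + τ * I) * (χ j).LFunction (z + τ * I) - LSeries (P j) z * f j z =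
        LSeries (P j) (z + τ * I) * ((χ j).LFunction (z + τ * I) - f j z) +
          (LSeries (P j) (z + τ * I) - LSeries (P j) z) * f j z := by ring
    rw [e1]
    refine (norm_add_le _ _).trans (add_le_add ?_ ?_)
    · rw [norm_mul]
      exact mul_le_mul (FiniteLSeries.norm_le (hsupp j) hzτ0) (hτL j z hz).le (norm_nonneg _)
        (hB0 j)
    · rw [norm_mul]
      have hshift : ‖LSeries (P j) (z + τ * I) - LSeries (P j) z‖ ≤ 2 * Real.pi * ε * B' j := by
        refine (FiniteLSeries.norm_shift_sub_le (hsupp j) hz0 τ).trans ?_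
        rw [hB', Finset.mul_sum]
        refine Finset.sum_le_sum fun n hn ↦ ?_
        obtain ⟨hn1, hn2⟩ := Finset.mem_filter.1 hn
        calc ‖P j n‖ * ‖(n : ℂ) ^ (((-τ : ℝ) : ℂ) * I) - 1‖
            ≤ ‖P j n‖ * (n * (2 * Real.pi * ε)) :=
              mul_le_mul_of_nonneg_left (hnphase n hn2 (hnQ j n hn1)) (norm_nonneg _)
          _ = 2 * Real.pi * ε * (‖P j n‖ * n) := by ring
      exact mul_le_mul hshift (hfM j z hz) (norm_nonneg _) (by positivity)
  -- Rouché
  have hgd : DiffContOnCl ℂ (fun s ↦ charCombination χ P (s + τ * I)) (ball (σ₀ : ℂ) r) := by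
    refine DifferentiableOn.diffContOnCl fun z hz ↦ DifferentiableAt.differentiableWithinAt ?_
    rw [closure_ball _ hr0.ne'] at hz
    have hz1 : (z + τ * I).re < 1 := by
      have : (z + τ * I).re = z.re := by simp
      rw [this]
      linarith [(hre z hz).2]
    have hcomp : (fun s ↦ charCombination χ P (s + τ * I)) =
        charCombination χ P ∘ fun s ↦ s + τ * I := rfl
    rw [hcomp]
    have hlin : DifferentiableAt ℂ (fun s : ℂ ↦ s + τ * I) z :=
      differentiableAt_fun_id.add_const _
    exact (hdiffF _ hz1).comp z hlin
  obtain ⟨z, hz, hz0⟩ := exists_zero_of_norm_sub_lt (f := fun s ↦ s - σ₀)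
    (g := fun s ↦ charCombination χ P (s + τ * I)) (δ := r) hr0 hgd (sub_self _)
    (fun w hw ↦ (mem_sphere_iff_norm.1 hw).ge) hclose
  refine ⟨z + τ * I, hz0, ?_, ?_⟩
  · have h := (abs_re_le_norm (z - σ₀)).trans_lt (mem_ball_iff_norm.1 hz)
    rw [sub_re, ofReal_re] at h
    simpa using h
  · have h := (abs_im_le_norm (z - σ₀)).trans_lt (mem_ball_iff_norm.1 hz)
    rw [sub_im, ofReal_im, sub_zero] at h
    simpa using h

/-! ### Theorem 2 in full, from hybrid joint universality and the right half -/

/-- **Saias–Weingartner 2009, Theorem 2, from `Pankowski2010_thm1_1_discAnalytic` and the right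
half.** "Then there exists a number `η = η(F) > 0` such that, for all real numbers `σ₁` and `σ₂`
with `1/2 ≤ σ₁ < σ₂ ≤ 1 + η` and all sufficiently large `T`, we have
`N'_F(σ₁, σ₂, T) ≫_{F,σ₁,σ₂} T`" — assembled as in the first sentence of §4: with `η` from the
right half `SaiasWeingartner2009_thm2_right` (the case `σ₁ ≥ 1`), a strip with `σ₁ < 1` contains
the strip `σ₁ < Re s < min(σ₂, 1)`, where `SaiasWeingartner2009_thm2_left_of_pankowski` applies,
and `HasLinearlyManyZeros` is monotone in the strip.
[cite: SaiasWeingartner2009, Thm. 2 and §4 (first sentence)] [cite: Pankowski2010, Cor. 5.3] -/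
theorem saiasWeingartner_thm2_of_pankowski (hU : Pankowski2010_thm1_1_discAnalytic)
    (hr : SaiasWeingartner2009_thm2_right) (ι : Type) [Fintype ι] (q : ι → ℕ)
    [∀ i, NeZero (q i)] (χ : ∀ i, DirichletCharacter ℂ (q i)) (P : ι → ℕ → ℂ)
    (hF : IsSWFamily χ P) :
    ∃ η : ℝ, 0 < η ∧ ∀ σ₁ σ₂ : ℝ, 1 / 2 ≤ σ₁ → σ₁ < σ₂ → σ₂ ≤ 1 + η →
      HasLinearlyManyZeros (charCombination χ P) σ₁ σ₂ := by
  obtain ⟨η, hη, hright⟩ := hr ι q χ P hF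
  refine ⟨η, hη, fun σ₁ σ₂ h₁ h₁₂ h₂ ↦ ?_⟩
  rcases lt_or_ge σ₁ 1 with hσ | hσ
  · exact (SaiasWeingartner2009_thm2_left_of_pankowski hU ι q χ P hF σ₁ (min σ₂ 1) h₁
      (lt_min h₁₂ hσ) (min_le_right _ _)).mono le_rfl (min_le_left _ _)
  · exact hright σ₁ σ₂ hσ h₁₂ h₂

end Literature.NumberTheory.LFunctions
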